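import Summits.QuantumFields.YangMills.Theorems.FlatTubeReductionDecimationSelectionDefs
import Summits.QuantumFields.YangMills.Theorems.FlatTubeReductionDecimationWindows
import HarnessLib

/-!
# Route `FlatTubeReduction`, crux `PinnedUnitStepEx` (stmt-QuantumFields-27561), stub `stub_smearVarPosGS1` — E1a: windows, max run, translation
# invariance and placement

Seat ym-line-fcl-p3 g9 (2026-08-28).  Blueprint v2 file E1 (first part): basic API of `HasWin` / `mrun` / `maxPot` / `shiftLinks`
(`hasWin_iff_le_mrun`, `isContr_of_hasWin_top`, `mrun_shiftLinks`, `maxPot_shiftLinks`, `mem_shiftLinks_iff`, `shiftLinks_shiftLinks`) and the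
PLACEMENT step of memo §P4: `exists_run_start` (a longest run is preceded by a non-contractible slice) and `exists_shift_normalForm_dir` (translate
in direction `j` so that slices `1, …, ℓ_j` are contractible and slice `0` is not; other directions untouched, `isContr_shiftLinks_of_ne`).
R2b1 RECORD rung; no summit/crux/stub here.
-/

set_option autoImplicit false

noncomputable section

namespace Summit.QuantumFields.YangMills.Theorems.FlatTubeReduction.Decimation

open Finset Function
open Literature.MathematicalPhysics.QuantumFieldTheory (Site Edge)

variable {M : ℕ} [NeZero M]

/-! ## Windows and the max run -/

omit [NeZero M] in
/-- The empty window. [folklore] -/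
theorem hasWin_zero (j : Fin 3) (R : Finset (Edge 3 M)) : HasWin j R 0 :=
  ⟨0, fun i hi => absurd hi (Nat.not_lt_zero i)⟩

omit [NeZero M] in
/-- Windows are downward closed in their length. [folklore] -/
theorem HasWin.mono {j : Fin 3} {R : Finset (Edge 3 M)} {t t' : ℕ} (h : HasWin j R t) (htt : t' ≤ t) : HasWin j R t' := by
  obtain ⟨c, hc⟩ := h
  exact ⟨c, fun i hi => hc i (lt_of_lt_of_le hi htt)⟩

/-- A window of full length `M` means every slice is contractible. [folklore] -/
theorem isContr_of_hasWin_top {j : Fin 3} {R : Finset (Edge 3 M)} (h : HasWin j R M) (a : ZMod M) : IsContr j a R := by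
  obtain ⟨c, hc⟩ := h
  have := hc (a - c).val (ZMod.val_lt _)
  rwa [ZMod.natCast_zmod_val, add_sub_cancel] at this

omit [NeZero M] in
/-- The max run bounds every window length `t ≤ M`. [folklore] -/
theorem le_mrun_of_hasWin {j : Fin 3} {R : Finset (Edge 3 M)} {t : ℕ} (ht : t ≤ M) (h : HasWin j R t) : t ≤ mrun j R := by
  classical
  unfold mrun
  exact Nat.le_findGreatest ht h

omit [NeZero M] in
/-- The max run is attained. [folklore] -/
theorem hasWin_mrun (j : Fin 3) (R : Finset (Edge 3 M)) : HasWin j R (mrun j R) := by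
  classical
  unfold mrun
  by_cases h : Nat.findGreatest (HasWin j R) M = 0
  · rw [h]; exact hasWin_zero j R
  · exact Nat.findGreatest_of_ne_zero rfl h

omit [NeZero M] in
/-- `mrun ≤ M`. [folklore] -/
theorem mrun_le (j : Fin 3) (R : Finset (Edge 3 M)) : mrun j R ≤ M := by
  classical
  unfold mrun
  exact Nat.findGreatest_le M

omit [NeZero M] in
/-- No window is longer than the max run (below the cap). [folklore] -/
theorem not_hasWin_succ_mrun {j : Fin 3} {R : Finset (Edge 3 M)} (h : mrun j R < M) : ¬ HasWin j R (mrun j R + 1) := by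
  intro hw
  have := le_mrun_of_hasWin (Nat.succ_le_of_lt h) hw
  omega

omit [NeZero M] in
/-- Windows of length `t ≤ M` exist iff `t ≤ mrun`. [folklore] -/
theorem hasWin_iff_le_mrun {j : Fin 3} {R : Finset (Edge 3 M)} {t : ℕ} (ht : t ≤ M) : HasWin j R t ↔ t ≤ mrun j R :=
  ⟨le_mrun_of_hasWin ht, fun h => (hasWin_mrun j R).mono h⟩

/-! ## Translation invariance -/

omit [NeZero M] in
/-- Contractible slices of a translate. [folklore] -/
theorem isContr_shiftLinks_iff (j : Fin 3) (a : ZMod M) (w : Site 3 M) (R : Finset (Edge 3 M)) :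
    IsContr j a (shiftLinks w R) ↔ IsContr j (a - w j) R :=
  isContr_shift_iff j a w R

omit [NeZero M] in
/-- Windows of a translate. [folklore] -/
theorem hasWin_shiftLinks_iff (j : Fin 3) (w : Site 3 M) (R : Finset (Edge 3 M)) (t : ℕ) :
    HasWin j (shiftLinks w R) t ↔ HasWin j R t := by
  constructor
  · rintro ⟨c, hc⟩
    refine ⟨c - w j, fun i hi => ?_⟩
    have := (isContr_shiftLinks_iff j _ w R).1 (hc i hi)
    rwa [add_sub_right_comm] at this
  · rintro ⟨c, hc⟩
    refine ⟨c + w j, fun i hi => (isContr_shiftLinks_iff j _ w R).2 ?_⟩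
    rw [add_right_comm, add_sub_cancel_right]
    exact hc i hi

omit [NeZero M] in
/-- The max run is translation invariant. [folklore] -/
theorem mrun_shiftLinks (j : Fin 3) (w : Site 3 M) (R : Finset (Edge 3 M)) : mrun j (shiftLinks w R) = mrun j R := by
  classical
  unfold mrun
  congr 1
  funext t
  exact propext (hasWin_shiftLinks_iff j w R t)

omit [NeZero M] in
/-- The potential is translation invariant. [folklore] -/
theorem maxPot_shiftLinks (w : Site 3 M) (R : Finset (Edge 3 M)) : maxPot (shiftLinks w R) = maxPot R := by
  unfold maxPot
  exact Finset.sum_congr rfl fun j _ => mrun_shiftLinks j w R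

omit [NeZero M] in
/-- Membership in a translate. [folklore] -/
theorem mem_shiftLinks_iff (w : Site 3 M) (R : Finset (Edge 3 M)) (y : Site 3 M) (i : Fin 3) :
    (y, i) ∈ shiftLinks w R ↔ (y - w, i) ∈ R := by
  unfold shiftLinks
  simp only [Finset.mem_image, Prod.mk.injEq, Prod.exists]
  constructor
  · rintro ⟨x, i', h, hx, rfl⟩
    rw [← hx, add_sub_cancel_right]; exact h
  · intro h
    exact ⟨y - w, i, h, sub_add_cancel y w, rfl⟩

omit [NeZero M] in
/-- Translating twice. [folklore] -/
theorem shiftLinks_shiftLinks (w w' : Site 3 M) (R : Finset (Edge 3 M)) :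
    shiftLinks w (shiftLinks w' R) = shiftLinks (w + w') R := by
  ext ⟨y, i⟩
  rw [mem_shiftLinks_iff, mem_shiftLinks_iff, mem_shiftLinks_iff, sub_sub, add_comm w w']

/-! ## Placement: normal form of a link set in one direction -/

omit [NeZero M] in
/-- **Start of a longest run**: if `0 < mrun j R < M` then some longest window `c, …, c + ℓ − 1` of contractible `j`-slices is preceded by a
NON-contractible slice `c − 1` (otherwise the window would extend). [folklore] -/
theorem exists_run_start {j : Fin 3} {R : Finset (Edge 3 M)} (hM : mrun j R < M) :
    ∃ c : ZMod M, (∀ i : ℕ, i < mrun j R → IsContr j (c + (i : ZMod M)) R) ∧ ¬ IsContr j (c - 1) R := by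
  obtain ⟨c, hc⟩ := hasWin_mrun j R
  refine ⟨c, hc, fun hprev => not_hasWin_succ_mrun hM ⟨c - 1, fun i hi => ?_⟩⟩
  rcases i with _ | i
  · simpa using hprev
  · have := hc i (by omega)
    have e : c - 1 + ((i + 1 : ℕ) : ZMod M) = c + (i : ZMod M) := by push_cast; ring
    rw [e]; exact this

omit [NeZero M] in
/-- **Placement in one direction**: translating by `w = (1 − c)·e_j` puts the start of a longest `j`-run at slice `1` and a non-contractible slice at `0`;
contractibility in the other directions is unchanged. [folklore] -/
theorem exists_shift_normalForm_dir (j : Fin 3) (R : Finset (Edge 3 M)) (hM : mrun j R < M) :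
    ∃ w : Site 3 M, (∀ k, k ≠ j → w k = 0) ∧
      (∀ i : ℕ, i < mrun j R → IsContr j (1 + (i : ZMod M)) (shiftLinks w R)) ∧ ¬ IsContr j 0 (shiftLinks w R) := by
  obtain ⟨c, hc, hprev⟩ := exists_run_start hM
  refine ⟨Pi.single j (1 - c), fun k hk => by simp [hk], fun i hi => ?_, ?_⟩
  · rw [isContr_shiftLinks_iff, Pi.single_eq_same]
    have := hc i hi
    convert this using 2; ring
  · rw [isContr_shiftLinks_iff, Pi.single_eq_same]
    have : (0 : ZMod M) - (1 - c) = c - 1 := by ring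
    rw [this]; exact hprev

omit [NeZero M] in
/-- Translating in direction `j` only does not change contractibility in the other directions. [folklore] -/
theorem isContr_shiftLinks_of_ne {j k : Fin 3} (hkj : k ≠ j) {w : Site 3 M} (hw : ∀ k', k' ≠ j → w k' = 0) (a : ZMod M)
    (R : Finset (Edge 3 M)) : IsContr k a (shiftLinks w R) ↔ IsContr k a R := by
  rw [isContr_shiftLinks_iff, hw k hkj, sub_zero]

end Summit.QuantumFields.YangMills.Theorems.FlatTubeReduction.Decimation
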